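import Literature.NumberTheory.EllipticCurves.SerreOpenImageSupersingularValuationProofs
import Literature.NumberTheory.EllipticCurves.TorsionCardinality
import HarnessLib

/-!
# Valuation of the abscissa of the `ℓ²`-torsion above the `ℓ`-torsion at a good supersingular
# prime (Serre 1972, §1.10–1.11: "level `1/(ℓ²(ℓ² - 1))`")

`Proofs` file (theorems only: no definition, no named fact), topic `NumberTheory/EllipticCurves`;
sequel of `SerreOpenImageSupersingularValuationProofs` (same setting and notation).  Let `E = W/ℚ`
be in global minimal form, `ℓ` an odd prime of good **supersingular** reduction (`¬ ℓ ∣ Δ_min`,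
`ℓ ∣ a_ℓ`), `v` the (multiplicative) valuation of the tree's place `placeOver ℓ` of `ℚ̄`,
`d = (ℓ² - 1)/2`.  The predecessor file proves Serre's Prop. 12 (`e = 1`) at the level of the
`ℓ`-torsion: every `Q = (x_Q, y_Q) ∈ E[ℓ] ∖ 0` has `v(x_Q) > 1` and `v(x_Q)^d · v(ℓ) = 1` (the
formal-group parameter `t = x/y` has valuation `1/(ℓ² - 1)`).  THIS FILE climbs one level of the
tower: for every point `P = (x, y) ∈ E(ℚ̄)` with **`ℓ • P = Q` a NONZERO `ℓ`-torsion point**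
(so `P ∈ E[ℓ²] ∖ E[ℓ]`),

* `Literature.NumberTheory.EllipticCurves.valuation_pow_mul_eq_one_of_zsmul_eq_torsion` —
  **`v(x) > 1` and `v(x)^{ℓ² d} · v(ℓ) = 1`** (at `ℓ = 3`: `v(x)^{36} · v(3) = 1`), i.e. the
  parameter of `P` has valuation `1/(ℓ²(ℓ² - 1))` — Serre, Invent. Math. 15 (1972), §1.10,
  Prop. 10 / §1.11 (the points of `E[ℓⁿ] ∖ E[ℓⁿ⁻¹]` of a height-two formal group over an
  absolutely unramified base lie at level `1/(ℓ^{2(n-1)}(ℓ² - 1))`), case `n = 2`.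

The proof needs no formal group: by the tree's univariate multiplication-by-`ℓ` formula
(`WeierstrassCurve.mul_eval_ΨSq_of_zsmul_eq`, Silverman *AEC* Ex. 3.7(d):
`x(ℓP) · ψ_ℓ(x)² = Φ_ℓ(x)`) we have `x_Q · ψ_ℓ(x)² = Φ_ℓ(x)` with `Φ_ℓ` monic of degree `ℓ²` and
`𝔓`-integral (Mathlib `coeff_Φ`, `natDegree_Φ_le`) and `ψ_ℓ = preΨ'_ℓ ≡ c₀ (mod ℓ)`
coefficientwise with `c₀` a unit (`dvd_coeff_preΨ'`, `not_dvd_coeff_preΨ'_zero`: Debry / Serre,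
the division polynomial of a supersingular curve is a nonzero constant).  With `a = v(x)`:
(i) `a > 1`, for otherwise `ψ_ℓ(x)` is a unit and `Φ_ℓ(x)` is integral, forcing `v(x_Q) ≤ 1`;
(ii) `v(Φ_ℓ(x)) = a^{ℓ²}` (the leading term dominates); (iii) if `v(ℓ) a^d < 1` then `ψ_ℓ(x)` is
a unit, `v(x_Q) = a^{ℓ²}` and `a^{ℓ² d} v(ℓ) = v(x_Q)^d v(ℓ) = 1`; if `v(ℓ) a^d ≥ 1` then
`v(ψ_ℓ(x)) ≤ v(ℓ) a^d`, so `a^{ℓ²} = v(x_Q) v(ψ_ℓ(x))² ≤ v(x_Q) v(ℓ)² a^{2d}`, `a ≤ v(x_Q) v(ℓ)²`,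
and `1 < (v(x_Q) v(ℓ)²)^d = (v(x_Q)^d v(ℓ)) · v(ℓ)^{2d-1} = v(ℓ)^{2d-1} < 1` — absurd.  This is
the Newton polygon of `Φ_ℓ(X) - x_Q ψ_ℓ(X)²`: a single side of slope `1/(ℓ² d)`.

Use (cell `b2b-bsdres`, team n1011, row T-b1ss): the first step of the proof that at a good
SUPERSINGULAR `3` the surjectivity of `ρ̄_{E,3}` lifts to the whole `3`-adic tower (C. Wuthrich,
Doc. Math. 19 (2014), Lemma 20 — the case left open by `Wuthrich2014/ThreeAdicImageOrdinaryProofs`):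
the abscissa of a point of exact order `9` has `36` conjugates under the inertia group at `3`.

## References

* [Serre1972] J.-P. Serre, *Propriétés galoisiennes des points d'ordre fini des courbes
  elliptiques*, Invent. Math. 15 (1972) 259–331, §1.10 Prop. 10, §1.11 Prop. 12.
* [SilvermanAEC2009] J. H. Silverman, *The Arithmetic of Elliptic Curves*, 2nd ed. (2009),
  Exercise 3.7 (d), (f).
* [Wuthrich2014] C. Wuthrich, Doc. Math. 19 (2014) 381–402, Lemma 20 (p. 399).
-/

noncomputable section

open scoped Classical

open Polynomial WeierstrassCurve

namespace Literature.NumberTheory.EllipticCurves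

variable (ℓ : ℕ) [Fact ℓ.Prime] {W : WeierstrassCurve ℚ} [W.IsGloballyMinimal] [W.IsElliptic]

omit [W.IsElliptic] in
/-- **The multiplication-by-`ℓ` formula on the minimal model, read in `ℚ̄`.**  If `P = (x, y)` and
`ℓ • P = Q = (x_Q, y_Q)` in `E(ℚ̄)`, then `x_Q · ψ_ℓ(x)² = Φ_ℓ(x)` for the integral division
polynomials `ψ_ℓ = preΨ'_ℓ`, `Φ_ℓ` of `integralModelInt W` (`ℓ` odd, so `ΨSq_ℓ = ψ_ℓ²`).
[cite: SilvermanAEC2009, Exercise 3.7 (d)] -/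
theorem mul_eval_preΨ'_sq_eq_eval_Φ_of_zsmul_eq (hℓ2 : ℓ ≠ 2) {P Q : W.geomPoints}
    (hPQ : (ℓ : ℤ) • P = Q) {x y : AlgebraicClosure ℚ} {h} (hPxy : P = .some x y h)
    {xQ yQ : AlgebraicClosure ℚ} {hQ'} (hQxy : Q = .some xQ yQ hQ') :
    xQ * ((((integralModelInt W).preΨ' ℓ).map (Int.castRingHom (AlgebraicClosure ℚ))).eval x) ^ 2 =
      (((integralModelInt W).Φ ℓ).map (Int.castRingHom (AlgebraicClosure ℚ))).eval x := by
  have hp : ℓ.Prime := Fact.out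
  have hodd : ¬ Even ℓ := fun h ↦ hℓ2 ((hp.even_iff).mp h)
  subst hPxy
  subst hQxy
  have hid := mul_eval_ΨSq_of_zsmul_eq _ h (ℓ : ℤ) hQ' hPQ
  -- `W_{ℚ̄}` (the curve underlying `W.geomPoints`) is `integralModelInt W` read in `ℚ̄`
  have e : @WeierstrassCurve.baseChange ℚ _ W (AlgebraicClosure ℚ) _
        (@AlgebraicClosure.instAlgebra ℚ _ ℚ _ _) =
      (integralModelInt W).map (Int.castRingHom (AlgebraicClosure ℚ)) := by
    conv_lhs => rw [← map_integralModelInt W]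
    rw [baseChange, WeierstrassCurve.map_map]
    exact congrArg (integralModelInt W).map (RingHom.ext_int _ _)
  rw [e, ΨSq_ofNat, if_neg hodd, mul_one, map_preΨ', eval_pow, map_Φ] at hid
  exact hid

/-- **The abscissa of a point of `E[ℓ²] ∖ E[ℓ]` at a good supersingular odd prime `ℓ`: `v(x) > 1`
and `v(x)^{ℓ²(ℓ²-1)/2} · v(ℓ) = 1`.**  Let `E/ℚ` be minimal (`W`), `ℓ` odd with `¬ ℓ ∣ Δ_min` and
`ℓ ∣ a_ℓ`, and let `P = (x, y) ∈ E(ℚ̄)` satisfy `ℓ • P = Q` with `Q` a NONZERO `ℓ`-torsion point.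
Then `1 < v(x)` and `v(x) ^ (ℓ² · ((ℓ² - 1)/2)) · v(ℓ) = 1` for the valuation `v` of the place
`placeOver ℓ` (Serre 1972, §1.10 Prop. 10 and §1.11: the parameter of such a point has valuation
`1/(ℓ²(ℓ² - 1))`; at `ℓ = 3`, `v(x)^{36} v(3) = 1`).  Proof: the two-slope analysis of
`x_Q ψ_ℓ(x)² = Φ_ℓ(x)` described in the module docstring.
[cite: Serre1972, §1.10 Prop. 10, §1.11 Prop. 12] [cite: SilvermanAEC2009, Exercise 3.7 (d), (f)] -/
theorem valuation_pow_mul_eq_one_of_zsmul_eq_torsion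
    (hΔ : ¬ (ℓ : ℤ) ∣ minimalDiscriminantInt W) (hss : (ℓ : ℤ) ∣ W.frobeniusTrace ℓ) (hℓ2 : ℓ ≠ 2)
    {P Q : W.geomPoints} (hPQ : (ℓ : ℤ) • P = Q) (hQ : (ℓ : ℤ) • Q = 0) (hQ0 : Q ≠ 0)
    {x y : AlgebraicClosure ℚ} {h} (hPxy : P = .some x y h) :
    1 < (placeOver ℓ).valuation x ∧
      (placeOver ℓ).valuation x ^ (ℓ ^ 2 * ((ℓ ^ 2 - 1) / 2)) * (placeOver ℓ).valuation ℓ = 1 := by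
  have hp : ℓ.Prime := Fact.out
  set v := (placeOver ℓ).valuation with hv
  set F := ((integralModelInt W).preΨ' ℓ).map (Int.castRingHom (AlgebraicClosure ℚ)) with hF
  set G := ((integralModelInt W).Φ ℓ).map (Int.castRingHom (AlgebraicClosure ℚ)) with hG
  set d := (ℓ ^ 2 - 1) / 2 with hd
  -- the nonzero `ℓ`-torsion point `Q = (xQ, yQ)` and the valuation of `xQ`
  obtain ⟨xQ, yQ, hQ', hQxy⟩ := geomPoints.exists_eq_some hQ0
  obtain ⟨hxQ1, hxQd⟩ := valuation_pow_mul_eq_one_of_isRoot ℓ hΔ hss hℓ2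
    (isRoot_preΨ'_of_zsmul_eq_zero ℓ hℓ2 hQ hQxy)
  rw [← hv] at hxQ1 hxQd
  -- the multiplication formula `xQ · F(x)² = G(x)`
  have hid : xQ * (F.eval x) ^ 2 = G.eval x :=
    mul_eval_preΨ'_sq_eq_eval_Φ_of_zsmul_eq ℓ hℓ2 hPQ hPxy hQxy
  -- degrees and coefficients
  obtain ⟨hdegF, hleadF⟩ := natDegree_preΨ'_map_eq ℓ (W := W) hℓ2
  rw [← hF, ← hd] at hdegF hleadF
  have hd1 : 1 ≤ d := by
    have h3 : 3 ≤ ℓ := by have := hp.two_le; omega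
    have : 8 ≤ ℓ ^ 2 - 1 := by
      have : 9 ≤ ℓ ^ 2 := by nlinarith
      omega
    rw [hd]; omega
  have hℓsq : ℓ ^ 2 = 2 * d + 1 := by
    have hodd : ¬ Even ℓ := fun h ↦ hℓ2 ((hp.even_iff).mp h)
    obtain ⟨k, hk⟩ := Nat.not_even_iff_odd.mp hodd
    rw [hd, hk]
    have : (2 * k + 1) ^ 2 - 1 = 2 * (2 * k ^ 2 + 2 * k) := by ring_nf; omega
    rw [this, Nat.mul_div_cancel_left _ two_pos]
    ring
  have hvℓ : v ℓ < 1 := valuation_placeOver_natCast_lt_one ℓ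
  have hvℓ0 : v ℓ ≠ 0 := by
    rw [hv, Valuation.ne_zero_iff]; exact_mod_cast hp.ne_zero
  have hint : ∀ n : ℤ, v (n : AlgebraicClosure ℚ) ≤ 1 := by
    intro n
    rcases em ((ℓ : ℤ) ∣ n) with hn | hn
    · exact ((valuation_placeOver_intCast_lt_one_iff ℓ).mpr hn).le
    · exact (valuation_placeOver_intCast_eq_one ℓ hn).le
  have hFcoeff : ∀ i, F.coeff i = (((integralModelInt W).preΨ' ℓ).coeff i : AlgebraicClosure ℚ) :=
    fun i ↦ by rw [hF, coeff_map, eq_intCast]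
  have hGcoeff : ∀ i, G.coeff i = (((integralModelInt W).Φ ℓ).coeff i : AlgebraicClosure ℚ) :=
    fun i ↦ by rw [hG, coeff_map, eq_intCast]
  have hFi : ∀ i, i ≠ 0 → v (F.coeff i) ≤ v ℓ := by
    intro i hi
    obtain ⟨m, hm⟩ := dvd_coeff_preΨ' ℓ hΔ hss hi
    rw [hFcoeff, hm, Int.cast_mul, Int.cast_natCast, map_mul]
    conv_rhs => rw [← mul_one (v ℓ)]
    gcongr
    exact hint m
  have hF0 : v (F.coeff 0) = 1 := by
    rw [hFcoeff]
    exact valuation_placeOver_intCast_eq_one ℓ (not_dvd_coeff_preΨ'_zero ℓ hΔ hss)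
  have hGi : ∀ i, v (G.coeff i) ≤ 1 := fun i ↦ by rw [hGcoeff]; exact hint _
  have hGdeg : G.natDegree ≤ ℓ ^ 2 := by
    rw [hG]
    refine (natDegree_map_le).trans ?_
    have := (integralModelInt W).natDegree_Φ_le (ℓ : ℤ)
    simp only [Int.natAbs_natCast] at this
    exact this
  have hGtop : G.coeff (ℓ ^ 2) = 1 := by
    rw [hGcoeff]
    have := (integralModelInt W).coeff_Φ (ℓ : ℤ)
    simp only [Int.natAbs_natCast] at this
    rw [this, Int.cast_one]
  -- the two evaluations as finite sums
  have hFsum : F.eval x = F.coeff 0 + ∑ i ∈ Finset.range d, F.coeff (i + 1) * x ^ (i + 1) := by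
    rw [eval_eq_sum_range' (lt_of_le_of_lt hdegF.le (Nat.lt_succ_self d)),
      Finset.sum_range_succ', pow_zero, mul_one, add_comm]
  have hGsum : G.eval x = (∑ i ∈ Finset.range (ℓ ^ 2), G.coeff i * x ^ i) + x ^ (ℓ ^ 2) := by
    rw [eval_eq_sum_range' (Nat.lt_succ_of_le hGdeg), Finset.sum_range_succ, hGtop, one_mul]
  -- (i) `v x > 1`
  have hx1 : 1 < v x := by
    by_contra hle
    rw [not_lt] at hle
    have hFx : v (F.eval x) = 1 := by
      rw [hFsum, Valuation.map_add_eq_of_lt_left _ ?_, hF0]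
      rw [hF0]
      refine Valuation.map_sum_lt _ one_ne_zero fun i _ ↦ ?_
      rw [map_mul, map_pow]
      calc v (F.coeff (i + 1)) * v x ^ (i + 1) ≤ v ℓ * 1 := by
            gcongr
            · exact hFi _ i.succ_ne_zero
            · exact pow_le_one₀ zero_le hle
        _ < 1 := by rwa [mul_one]
    have hGx : v (G.eval x) ≤ 1 := by
      rw [hGsum]
      refine Valuation.map_add_le _ (Valuation.map_sum_le _ fun i _ ↦ ?_)
        (by rw [map_pow]; exact pow_le_one₀ zero_le hle)
      rw [map_mul, map_pow]
      calc v (G.coeff i) * v x ^ i ≤ 1 * 1 := by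
            gcongr
            · exact hGi i
            · exact pow_le_one₀ zero_le hle
        _ = 1 := mul_one 1
    have h1 : v xQ ≤ 1 := by
      have := congrArg v hid
      rw [map_mul, map_pow, hFx, one_pow, mul_one] at this
      rw [this]; exact hGx
    exact (not_lt.mpr h1) hxQ1
  refine ⟨hx1, ?_⟩
  have hxne : v x ≠ 0 := by rintro h; rw [h] at hx1; exact not_lt_zero hx1
  -- (ii) `v (G x) = (v x) ^ ℓ²`
  have hGx : v (G.eval x) = v x ^ (ℓ ^ 2) := by
    rw [hGsum, add_comm, Valuation.map_add_eq_of_lt_left _ ?_, map_pow]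
    rw [map_pow]
    refine Valuation.map_sum_lt _ (pow_ne_zero _ hxne) fun i hi ↦ ?_
    rw [Finset.mem_range] at hi
    rw [map_mul, map_pow]
    calc v (G.coeff i) * v x ^ i ≤ 1 * v x ^ i := by gcongr; exact hGi i
      _ = v x ^ i := one_mul _
      _ < v x ^ (ℓ ^ 2) := pow_lt_pow_right₀ hx1 hi
  -- (iii) the two cases for `ψ_ℓ(x)`
  by_cases hcase : v ℓ * v x ^ d < 1
  · -- `ψ_ℓ(x)` is a unit, `v xQ = (v x)^{ℓ²}`
    have hFx : v (F.eval x) = 1 := by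
      rw [hFsum, Valuation.map_add_eq_of_lt_left _ ?_, hF0]
      rw [hF0]
      refine Valuation.map_sum_lt _ one_ne_zero fun i hi ↦ ?_
      rw [Finset.mem_range] at hi
      rw [map_mul, map_pow]
      calc v (F.coeff (i + 1)) * v x ^ (i + 1) ≤ v ℓ * v x ^ d :=
            mul_le_mul' (hFi _ i.succ_ne_zero) (pow_le_pow_right₀ hx1.le (by omega))
        _ < 1 := hcase
    have hxQ : v xQ = v x ^ (ℓ ^ 2) := by
      have := congrArg v hid
      rwa [map_mul, map_pow, hFx, one_pow, mul_one, hGx] at this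
    rw [pow_mul, ← hxQ]
    exact hxQd
  · -- `v (ψ_ℓ(x)) ≤ v ℓ · (v x)^d` leads to a contradiction
    exfalso
    rw [not_lt] at hcase
    have hFx : v (F.eval x) ≤ v ℓ * v x ^ d := by
      rw [hFsum]
      refine Valuation.map_add_le _ (hF0.le.trans hcase) (Valuation.map_sum_le _ fun i hi ↦ ?_)
      rw [Finset.mem_range] at hi
      rw [map_mul, map_pow]
      exact mul_le_mul' (hFi _ i.succ_ne_zero) (pow_le_pow_right₀ hx1.le (by omega))
    -- `(v x)^{ℓ²} ≤ v xQ · (v ℓ)² · (v x)^{2d}`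
    have h1 : v x ^ (ℓ ^ 2) ≤ v xQ * (v ℓ * v x ^ d) ^ 2 := by
      have := congrArg v hid
      rw [map_mul, map_pow, hGx] at this
      rw [← this]
      exact mul_le_mul' le_rfl (pow_le_pow_left₀ zero_le hFx 2)
    -- cancel `(v x)^{2d}`: `v x ≤ v xQ · (v ℓ)²`
    have h2 : v x ≤ v xQ * v ℓ ^ 2 := by
      rw [hℓsq, pow_succ, mul_pow, ← pow_mul, mul_comm 2 d] at h1
      have hpos : 0 < v x ^ (d * 2) := pow_pos (zero_lt_iff.mpr hxne) _
      have h1' : v x ^ (d * 2) * v x ≤ v x ^ (d * 2) * (v xQ * v ℓ ^ 2) := by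
        calc v x ^ (d * 2) * v x ≤ v xQ * (v ℓ ^ 2 * v x ^ (d * 2)) := h1
          _ = v x ^ (d * 2) * (v xQ * v ℓ ^ 2) := by
              rw [mul_comm (v x ^ (d * 2)) _, mul_assoc]
      exact le_of_mul_le_mul_left h1' hpos
    -- hence `1 < (v xQ · v ℓ²)^d = (v xQ^d · v ℓ) · v ℓ^(2d-1) = v ℓ^(2d-1) < 1`
    have h3 : 1 < (v xQ * v ℓ ^ 2) ^ d := by
      obtain ⟨d', hd'⟩ : ∃ d', d = d' + 1 := ⟨d - 1, by omega⟩
      rw [hd']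
      exact one_lt_pow_succ_of_one_lt (lt_of_lt_of_le hx1 h2) d'
    obtain ⟨k, hk⟩ : ∃ k, 2 * d = k + 1 := ⟨2 * d - 1, by omega⟩
    have h4 : (v xQ * v ℓ ^ 2) ^ d = v ℓ ^ k := by
      have e1 : (v xQ * v ℓ ^ 2) ^ d = (v xQ ^ d * v ℓ) * v ℓ ^ k := by
        rw [mul_pow, ← pow_mul, hk, pow_succ, mul_comm (v ℓ ^ k) (v ℓ), ← mul_assoc]
      rw [e1, hxQd, one_mul]
    have h5 : v ℓ ^ k < 1 := by
      obtain ⟨k', hk'⟩ : ∃ k', k = k' + 1 := ⟨k - 1, by omega⟩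
      rw [hk']
      exact pow_lt_one₀ zero_le hvℓ (Nat.succ_ne_zero k')
    rw [h4] at h3
    exact (lt_irrefl _) (h3.trans h5)

/-- **The case `ℓ = 3`: `v(x)^{36} · v(3) = 1`** for the abscissa `x` of every `P ∈ E(ℚ̄)` with
`3 • P` a nonzero `3`-torsion point, at a good supersingular `3` (`¬ 3 ∣ Δ_min`, `3 ∣ a_3`).
[cite: Serre1972, §1.10 Prop. 10, §1.11 Prop. 12] -/
theorem valuation_pow_thirtySix_mul_eq_one_of_three_zsmul_eq_torsion
    (hΔ : ¬ (3 : ℤ) ∣ minimalDiscriminantInt W) (hss : (3 : ℤ) ∣ W.frobeniusTrace 3)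
    {P Q : W.geomPoints} (hPQ : (3 : ℤ) • P = Q) (hQ : (3 : ℤ) • Q = 0) (hQ0 : Q ≠ 0)
    {x y : AlgebraicClosure ℚ} {h} (hPxy : P = .some x y h) :
    1 < (placeOver 3).valuation x ∧
      (placeOver 3).valuation x ^ 36 * (placeOver 3).valuation (3 : ℕ) = 1 := by
  haveI : Fact (Nat.Prime 3) := ⟨Nat.prime_three⟩
  have h := valuation_pow_mul_eq_one_of_zsmul_eq_torsion 3 hΔ hss (by decide)
    (by exact_mod_cast hPQ) (by exact_mod_cast hQ) hQ0 hPxy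
  norm_num at h
  exact h

end Literature.NumberTheory.EllipticCurves

end
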